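import Literature.Probability.LatticeModels.MagnetizationExponentUpperAF57
import Literature.Probability.LatticeModels.ClusterDeficit
import HarnessLib

/-!
# Discharge of `spontaneousMagnetization_le_sqrt`: `M(β) ≤ C (β - β_c)^{1/2}` for `d > 4`

Topic `Probability/LatticeModels`, namespace `Literature.Probability.LatticeModels`. The last link of
the chain

* `ClusterDeficit.thetaCorr_singleton_sub_corrIn_le` — Aizenman–Fernández 1986, Lemma 5.5 (the
  random-walk input), for the backbone kernel `bbKernel` (`BackboneKernel`, Def. 4.5, Prop. 4.7);
* `AFBetaDerivativeKernelBoundTorus.torusDbeta_ge_of_kernel` — Theorem 5.6 ((5.19)) on the tori from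
  any kernel with (K0)–(K2);
* `MagnetizationExponentUpperAF57.spontaneousMagnetization_le_sqrt_of_af56Torus` — Theorem 5.7(b)
  on the tori from (5.19), the restricted differential inequality, and the extrapolation argument of
  Aizenman–Barsky–Fernández / Fernández–Fröhlich–Sokal §14.4.2 (`MagnetizationExponentUpperAFeR`,
  `MagnetizationExponentUpperAFe`, `MagnetizationExponentUpperProofs`),

giving `theorem spontaneousMagnetization_le_sqrt_holds : spontaneousMagnetization_le_sqrt`
(Aizenman–Fernández 1986: the mean-field bound `β̂ ≤ 1/2`, i.e. `M(β) ≤ C(β - β_c)^{1/2}` as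
`β ↓ β_c`, for the nearest-neighbour Ising model in `d > 4` dimensions).

## References

* M. Aizenman, R. Fernández, *On the critical behavior of the magnetization in high-dimensional
  Ising models*, J. Stat. Phys. **44** (1986) 393–454, §1 (1.9), (1.16); §4.3 Def. 4.5, Prop. 4.7;
  §5.1 Lemma 5.5; §5.2 Thms. 5.6–5.8 [AizenmanFernandezJSP1986].
* R. Fernández, J. Fröhlich, A. Sokal, *Random Walks, Critical Phenomena, and Triviality in Quantum
  Field Theory*, Springer 1992, §14.4.2 [FernandezFrohlichSokalSpringer1992].
-/

noncomputable section

open Finset MeasureTheory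
open scoped symmDiff ENNReal

namespace Literature.Probability.LatticeModels

/-- **Aizenman–Fernández's Theorem 5.6 on the discrete torus** ((5.19): `∂M/∂β ≥ deg χ [M - tanh(βh)
B_L]₊ / (1 + 2β deg B_L)`, `∂M/∂β = torusDbeta`), from `torusDbeta_ge_of_kernel` with the backbone
kernel `K = bbKernel` (any injective ranking of the pairs): (K0) `bbKernel_nonneg`, (K1) Lemma 5.5
`thetaCorr_singleton_sub_corrIn_le`, (K2) Prop. 4.7 `bbKernel_le_thetaCorr_zeroField`. [cite: AizenmanFernandezJSP1986, §5.2, Thm. 5.6, eq. (5.19), p. 431] -/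
theorem torusDbeta_ge_af56 {d L : ℕ} [NeZero L] {β h : ℝ} (_hL : 3 ≤ L) (hβ : 0 < β) (_hβc : β < criticalBeta d)
    (hh : 0 < h) :
    ((univ.filter ((torusGraph d L).Adj (0 : TorusSite d L))).card : ℝ) * torusSusc d L β h *
          max (torusMag d L β h - Real.tanh (β * h) * torusBubble d L β) 0 /
        (1 + 2 * β * ((univ.filter ((torusGraph d L).Adj (0 : TorusSite d L))).card : ℝ) * torusBubble d L β) ≤
      torusDbeta d L β h := by
  classical
  set θ : Sym2 (Option (TorusSite d L)) → ℝ := ghostCoupling β (β * h) with hθdef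
  have hθ : ∀ e, 0 ≤ θ e := fun e => ghostCoupling_nonneg hβ.le (mul_nonneg hβ.le hh.le) e
  set rk : Sym2 (Option (TorusSite d L)) → ℕ := fun e => (Fintype.equivFin (Sym2 (Option (TorusSite d L))) e : ℕ) with hrkdef
  have hrkinj : Function.Injective rk := fun a b hab =>
    (Fintype.equivFin (Sym2 (Option (TorusSite d L)))).injective (Fin.val_injective hab)
  have hrk : Set.InjOn rk ↑(edgesIn (ghostGraph (torusGraph d L) (univ : Finset (TorusSite d L)))
      (Finset.insertNone (univ : Finset (TorusSite d L)))) := hrkinj.injOn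
  refine torusDbeta_ge_of_kernel hβ.le hh.le (fun v k => bbKernel (torusGraph d L) univ rk θ v k)
    (fun v k => bbKernel_nonneg rk hθ v k) (fun S hnS v => ?_)
    (fun v k => (bbKernel_le_thetaCorr_zeroField rk hθ hrk (mem_univ v) (mem_univ k)).trans_eq
      (by rw [hθdef]; exact thetaCorr_zeroField_pair_eq β h v k))
  have h1 := thetaCorr_singleton_sub_corrIn_le (G := torusGraph d L) (Λ := univ) rk hθ hrk hnS (mem_univ v)
  refine h1.trans (le_of_eq ?_)
  simp only [hθdef, ghostCoupling_ghostEdge, ghostCoupling_liftEdge]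
  rw [mul_sum, ← sum_add_distrib]
  refine sum_congr rfl fun k _ => ?_
  rw [mul_add, mul_sum, mul_comm (Real.tanh (β * h))]
  congr 1
  exact sum_congr rfl fun l _ => by ring

/-- **Discharge of `spontaneousMagnetization_le_sqrt`** (Aizenman–Fernández 1986: for the
nearest-neighbour Ising model on `ℤᵈ`, `d > 4`, `M(β) ≤ C (β - β_c)^{1/2}` for `β` slightly above
`β_c`; the mean-field value `β̂ = 1/2` of the magnetisation exponent as an upper bound). [cite: AizenmanFernandezJSP1986, §1, eq. (1.9) and Cor. after Thm. 5.8 ("for d > 4 … β̂ = 1/2"); §5.2, Thms. 5.6–5.7] [cite: FernandezFrohlichSokalSpringer1992, §14.4.2, eqs. (14.278)–(14.284)] -/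
theorem spontaneousMagnetization_le_sqrt_holds : spontaneousMagnetization_le_sqrt :=
  spontaneousMagnetization_le_sqrt_of_af56Torus fun hL hβ hβc hh => torusDbeta_ge_af56 hL hβ hβc hh

end Literature.Probability.LatticeModels
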